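import Summits.HodgeConjecture.CorCM.CyclotomicFourPIntegers
import HarnessLib

/-!
# `±i` is not a norm from `ℤ[ζ_{4p}]` to the fixed ring of `ζ_{4p} ↦ ζ_{4p}^{2p−1}` when `p ≡ 5 (mod 8)`: the descent

COR-CM (cell `pub-hodgecm2`), binder seat b04 (gen 25), count-neutral claim CYCLIC-SEMIDIRECT-EIGHT, part IIIb (sequel of
`CorCM/CyclotomicFourPIntegers`; part IIIc `CorCM/CyclotomicFourPNormObstruction` transports the result to the subfield
`ℚ(ζ_{4p}) ⊆ ℂ` in the form consumed by parts I–II).  Mathlib only.  KERNEL ONLY: theorems; no definition, no named fact,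
no `sorry`.

SETTING.  `Λ = ℤ[X]/(Φ_{4p})` with generator `μ`, `p ≡ 5 (mod 8)` prime, `ρ̃ : Λ → Λ` the automorphism `μ ↦ μ^{2p−1}`
(it fixes `i = μ^p` and inverts `ζ_p = μ⁴`; its fixed field in `ℚ(ζ_{4p})` is `ℚ(i, ζ_p + ζ_p⁻¹)`), `g = 1 + μ²`, `η = −μ²`,
`π_s : Λ → 𝔽_p` the reduction `μ ↦ s` at a square root `s` of `−1` (part IIIa).

THEOREM (`descent`).  There are no `Z ∈ Λ`, `n ≥ 1`, `j` odd and `U ∈ Λ` with `π_s(U)` a non-zero square such that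
  `Z · ρ̃(Z) = n² · μ^{pj} · U`.
(For `U = 1` this says: `w ρ̃(w) ≠ ±i` for every `w = Z/n ∈ ℚ(ζ_{4p})`, i.e. `±i ∉ N_{ℚ(ζ_{4p})/ℚ(i, ζ_p⁺)}`.)  PROOF —
an elementary stand-in for the local computation at the prime `𝔓 = (p, μ − s)`: `π_s ∘ ρ̃ = π_s` (`s^{2p−1} = s` as
`2p − 1 ≡ 1 (mod 8)`), so reducing the relation gives `π_s(Z)² = n̄² s^{±1} c²`.  If `p ∤ n` then `x = π_s(Z)/(n̄ c)` has
`x² = ±s`, `x⁴ = −1`, hence `x^{p−1} = (x⁴)^{(p−1)/4} = −1` (`(p−1)/4` odd) against Fermat.  If `p ∣ n` then `π_{±s}(Z) = 0`,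
so `Z = g Z₁` (IIIa, kernel lemma), and since `ρ̃(g) = g·ε₂` with `ε₂ = −η⁻¹` a unit and `p = g^{p−1} ε`, the factor `g²`
cancels: after `p − 1` such steps `Z' ρ̃(Z') = (n/p)² μ^{pj} U'` with `π_s(U') = (π_s(ε₂')^{(p−1)/2} π_s(ε) c)²` again a
non-zero square — contradiction by induction on `n`.

* §1 `coprime_two_mul_sub_one`, `lift_rho_eq` (`π_s ∘ ρ̃ = π_s`), `lift_root_pow_sq` (`π_s(μ^{pj})² = −1`).
* §2 `peel`, `peel_iter` — one `g`-adic step and its iteration.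
* §3 **`descent`**.

## References

* [FeinGordonSmith1971] B. Fein, B. Gordon, J. H. Smith, J. Number Theory 3 (1971), 310–315.
* [Washington1997] L. C. Washington, *Introduction to Cyclotomic Fields*, Prop. 2.8, Thm. 2.13.
-/

noncomputable section

open Polynomial

namespace Summit.HodgeConjecture.CorCM.CyclotomicFourP

variable {p : ℕ}

/-! ## §1 The automorphism `ρ̃ : μ ↦ μ^{2p−1}` and the reduction `π_s` -/

/-- `gcd(2p − 1, 4p) = 1`. [folklore] -/
theorem coprime_two_mul_sub_one (hp : 0 < p) : (2 * p - 1).Coprime (4 * p) := by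
  have h : 4 * p = 2 + 2 * (2 * p - 1) := by omega
  rw [Nat.Coprime, h, Nat.gcd_add_mul_right_right]
  exact Nat.coprime_two_right.2 (by rw [Nat.odd_iff]; omega)

/-- **`π_s ∘ ρ̃ = π_s`**: `s^{2p−1} = s` because `p ≡ 1 (mod 4)`. [folklore] -/
theorem lift_rho_eq (hp : p.Prime) (hp2 : p ≠ 2) (hp4 : p % 4 = 1) {s : ZMod p} (hs : s ^ 2 = -1)
    (Z : AdjoinRoot (cyclotomic (4 * p) ℤ)) :
    AdjoinRoot.lift (Int.castRingHom (ZMod p)) s (eval₂_cyclotomic_four_mul hp hp2 hs)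
        (AdjoinRoot.lift (algebraMap ℤ _) (AdjoinRoot.root (cyclotomic (4 * p) ℤ) ^ (2 * p - 1))
          (eval₂_root_pow_cyclotomic hp.pos (coprime_two_mul_sub_one hp.pos)) Z) =
      AdjoinRoot.lift (Int.castRingHom (ZMod p)) s (eval₂_cyclotomic_four_mul hp hp2 hs) Z := by
  have hs4 : s ^ 4 = 1 := by rw [show (4 : ℕ) = 2 * 2 by norm_num, pow_mul, hs, neg_one_sq]
  have key := ringHom_ext (T := ZMod p)
    (φ₁ := (AdjoinRoot.lift (Int.castRingHom (ZMod p)) s (eval₂_cyclotomic_four_mul hp hp2 hs)).comp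
      (AdjoinRoot.lift (algebraMap ℤ _) (AdjoinRoot.root (cyclotomic (4 * p) ℤ) ^ (2 * p - 1))
        (eval₂_root_pow_cyclotomic hp.pos (coprime_two_mul_sub_one hp.pos))))
    (φ₂ := AdjoinRoot.lift (Int.castRingHom (ZMod p)) s (eval₂_cyclotomic_four_mul hp hp2 hs)) (by
      rw [RingHom.comp_apply, AdjoinRoot.lift_root, map_pow, AdjoinRoot.lift_root]
      obtain ⟨k, hk⟩ : ∃ k, p = 4 * k + 1 := ⟨p / 4, by omega⟩
      rw [show 2 * p - 1 = 4 * (2 * k) + 1 by omega, pow_succ, pow_mul, hs4, one_pow, one_mul])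
  exact DFunLike.congr_fun key Z

/-- `π_s(μ^{pj})² = −1` for `j` odd (`p` odd): `ω̃ = μ^{pj}` reduces to `±s`. [folklore] -/
theorem lift_root_pow_sq (hp : p.Prime) (hp2 : p ≠ 2) {s : ZMod p} (hs : s ^ 2 = -1) {j : ℕ} (hj : Odd j) :
    (AdjoinRoot.lift (Int.castRingHom (ZMod p)) s (eval₂_cyclotomic_four_mul hp hp2 hs)
      (AdjoinRoot.root (cyclotomic (4 * p) ℤ) ^ (p * j))) ^ 2 = -1 := by
  rw [map_pow, AdjoinRoot.lift_root, ← pow_mul, mul_comm, pow_mul, hs]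
  exact ((hp.odd_of_ne_two hp2).mul hj).neg_one_pow

/-! ## §2 One `g`-adic step -/

/-- **Peeling one factor of `g = 1 + μ²`.**  If `Z ρ̃(Z) = g^{2(k+1)} V` then `π_{±s}(Z) = 0`, so `Z = g Z₁`, and
`Z₁ ρ̃(Z₁) = g^{2k} · (−η) · V` (`ρ̃(g) = g ε₂`, `ε₂ · (−η) = 1`). [cite: Washington1997, Prop. 2.8] -/
theorem peel (hp : p.Prime) (hp8 : p % 8 = 5) {s : ZMod p} (hs : s ^ 2 = -1) (k : ℕ)
    (Z V : AdjoinRoot (cyclotomic (4 * p) ℤ))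
    (hZ : Z * AdjoinRoot.lift (algebraMap ℤ _) (AdjoinRoot.root (cyclotomic (4 * p) ℤ) ^ (2 * p - 1))
      (eval₂_root_pow_cyclotomic hp.pos (coprime_two_mul_sub_one hp.pos)) Z =
      (1 + AdjoinRoot.root (cyclotomic (4 * p) ℤ) ^ 2) ^ (2 * (k + 1)) * V) :
    ∃ Z₁ : AdjoinRoot (cyclotomic (4 * p) ℤ),
      Z₁ * AdjoinRoot.lift (algebraMap ℤ _) (AdjoinRoot.root (cyclotomic (4 * p) ℤ) ^ (2 * p - 1))
        (eval₂_root_pow_cyclotomic hp.pos (coprime_two_mul_sub_one hp.pos)) Z₁ =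
      (1 + AdjoinRoot.root (cyclotomic (4 * p) ℤ) ^ 2) ^ (2 * k) * ((-(-(AdjoinRoot.root (cyclotomic (4 * p) ℤ)) ^ 2)) * V) := by
  have hp2 : p ≠ 2 := by rintro rfl; norm_num at hp8
  have hp4 : p % 4 = 1 := by omega
  haveI := isDomain hp.pos
  haveI : Fact p.Prime := ⟨hp⟩
  set μ := AdjoinRoot.root (cyclotomic (4 * p) ℤ) with hμ_def
  set ρ := AdjoinRoot.lift (algebraMap ℤ _) (μ ^ (2 * p - 1))
    (eval₂_root_pow_cyclotomic hp.pos (coprime_two_mul_sub_one hp.pos)) with hρ_def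
  have hs' : (-s) ^ 2 = -1 := by rw [neg_sq, hs]
  -- `π_{±s}(Z) = 0`
  have hvan : ∀ {t : ZMod p} (ht : t ^ 2 = -1),
      AdjoinRoot.lift (Int.castRingHom (ZMod p)) t (eval₂_cyclotomic_four_mul hp hp2 ht) Z = 0 := by
    intro t ht
    have h := congrArg (AdjoinRoot.lift (Int.castRingHom (ZMod p)) t (eval₂_cyclotomic_four_mul hp hp2 ht)) hZ
    rw [map_mul, lift_rho_eq hp hp2 hp4 ht, map_mul, map_pow, map_add, map_one, map_pow, AdjoinRoot.lift_root, ht,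
      add_neg_cancel, zero_pow (by omega), zero_mul] at h
    exact mul_self_eq_zero.1 h
  obtain ⟨Z₁, rfl⟩ := exists_eq_mul_of_lift_eq_zero hp hp2 hs hs' Z (hvan hs) (hvan hs')
  refine ⟨Z₁, ?_⟩
  obtain ⟨hρg, hinv⟩ := one_add_root_pow_eq hp hp2
  have hρμ : ρ (1 + μ ^ 2) = 1 + (μ ^ (2 * p - 1)) ^ 2 := by
    rw [map_add, map_one, map_pow, hρ_def, AdjoinRoot.lift_root]
  -- `g ρ(g) Z₁ ρ(Z₁) = g^{2k+2} V`, `ρ(g) = g ε₂`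
  rw [map_mul, hρμ, hρg] at hZ
  have hg := one_add_root_sq_ne_zero hp hp2
  have h2 : (1 + μ ^ 2) ^ 2 * ((∑ m ∈ Finset.range (p - 1), (-μ ^ 2) ^ m) * (Z₁ * ρ Z₁)) =
      (1 + μ ^ 2) ^ 2 * ((1 + μ ^ 2) ^ (2 * k) * V) := by
    rw [show 2 * (k + 1) = 2 + 2 * k by ring, pow_add] at hZ
    linear_combination hZ
  have h3 := mul_left_cancel₀ (pow_ne_zero 2 hg) h2
  -- multiply by `ε₂' = -η`
  have h4 := congrArg (fun x => -(-μ ^ 2) * x) h3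
  rw [← mul_assoc, mul_comm (-(-μ ^ 2)), hinv, one_mul] at h4
  rw [h4]
  ring

/-- **Iterated peeling**: `Z ρ̃(Z) = g^{2m} V ⟹ ∃ Z', Z' ρ̃(Z') = (−η)^m V`. [cite: Washington1997, Prop. 2.8] -/
theorem peel_iter (hp : p.Prime) (hp8 : p % 8 = 5) {s : ZMod p} (hs : s ^ 2 = -1) :
    ∀ (m : ℕ) (Z V : AdjoinRoot (cyclotomic (4 * p) ℤ)),
      Z * AdjoinRoot.lift (algebraMap ℤ _) (AdjoinRoot.root (cyclotomic (4 * p) ℤ) ^ (2 * p - 1))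
        (eval₂_root_pow_cyclotomic hp.pos (coprime_two_mul_sub_one hp.pos)) Z =
        (1 + AdjoinRoot.root (cyclotomic (4 * p) ℤ) ^ 2) ^ (2 * m) * V →
      ∃ Z' : AdjoinRoot (cyclotomic (4 * p) ℤ),
        Z' * AdjoinRoot.lift (algebraMap ℤ _) (AdjoinRoot.root (cyclotomic (4 * p) ℤ) ^ (2 * p - 1))
          (eval₂_root_pow_cyclotomic hp.pos (coprime_two_mul_sub_one hp.pos)) Z' =
        (-(-(AdjoinRoot.root (cyclotomic (4 * p) ℤ)) ^ 2)) ^ m * V := by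
  intro m
  induction m with
  | zero =>
    intro Z V h
    exact ⟨Z, by rw [h, mul_zero, pow_zero, one_mul, pow_zero, one_mul]⟩
  | succ m ih =>
    intro Z V h
    obtain ⟨Z₁, h₁⟩ := peel hp hp8 hs m Z V h
    obtain ⟨Z', h'⟩ := ih Z₁ _ h₁
    exact ⟨Z', by rw [h', ← mul_assoc, ← pow_succ]⟩

/-! ## §3 The descent -/

/-- **THE DESCENT.**  `p ≡ 5 (mod 8)`, `s² = −1` in `𝔽_p`, `j` odd.  There are no `n ≥ 1`, `Z, U ∈ Λ` and `c ∈ 𝔽_pˣ` with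
`π_s(U) = c²` and `Z ρ̃(Z) = n² μ^{pj} U`.  (With `U = 1`: `±i` is not a norm from `ℚ(ζ_{4p})` to `ℚ(i, ζ_p + ζ_p⁻¹)`.)
[cite: FeinGordonSmith1971, pp. 310–315] -/
theorem descent (hp : p.Prime) (hp8 : p % 8 = 5) {s : ZMod p} (hs : s ^ 2 = -1) {j : ℕ} (hj : Odd j) :
    ∀ (n : ℕ), 0 < n → ∀ (Z U : AdjoinRoot (cyclotomic (4 * p) ℤ)) (c : ZMod p), c ≠ 0 →
      AdjoinRoot.lift (Int.castRingHom (ZMod p)) s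
        (eval₂_cyclotomic_four_mul hp (by rintro rfl; norm_num at hp8) hs) U = c ^ 2 →
      Z * AdjoinRoot.lift (algebraMap ℤ _) (AdjoinRoot.root (cyclotomic (4 * p) ℤ) ^ (2 * p - 1))
        (eval₂_root_pow_cyclotomic hp.pos (coprime_two_mul_sub_one hp.pos)) Z =
        (n : AdjoinRoot (cyclotomic (4 * p) ℤ)) ^ 2 * (AdjoinRoot.root (cyclotomic (4 * p) ℤ) ^ (p * j) * U) →
      False := by
  have hp2 : p ≠ 2 := by rintro rfl; norm_num at hp8
  have hp4 : p % 4 = 1 := by omega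
  haveI := isDomain hp.pos
  haveI : Fact p.Prime := ⟨hp⟩
  set μ := AdjoinRoot.root (cyclotomic (4 * p) ℤ) with hμ_def
  set ρ := AdjoinRoot.lift (algebraMap ℤ _) (μ ^ (2 * p - 1))
    (eval₂_root_pow_cyclotomic hp.pos (coprime_two_mul_sub_one hp.pos)) with hρ_def
  set π := AdjoinRoot.lift (Int.castRingHom (ZMod p)) s (eval₂_cyclotomic_four_mul hp hp2 hs) with hπ_def
  have hπρ : ∀ Z, π (ρ Z) = π Z := lift_rho_eq hp hp2 hp4 hs
  have hω : (π (μ ^ (p * j))) ^ 2 = -1 := lift_root_pow_sq hp hp2 hs hj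
  -- the units `ε` (`p = g^{p-1} ε`) and `ε₂' = -η`
  set ε := ∏ j ∈ Finset.range (p - 1), ∑ m ∈ Finset.range (j + 1), (-μ ^ 2) ^ m with hε_def
  have hpε : ((p : ℕ) : AdjoinRoot (cyclotomic (4 * p) ℤ)) = (1 + μ ^ 2) ^ (p - 1) * ε := prime_eq_pow_mul hp hp2
  have hπε : π ε ≠ 0 := lift_eps_ne_zero hp hp2 hs
  have hπη : π (-(-μ ^ 2)) = -1 := by rw [map_neg, hπ_def, lift_eta hp hp2 hs]
  intro n
  induction n using Nat.strong_induction_on with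
  | _ n ih =>
  intro hn Z U c hc hU hrel
  by_cases hpn : p ∣ n
  · -- `p ∣ n`: peel `p - 1` factors of `g` and descend
    obtain ⟨n', rfl⟩ := hpn
    have hn' : 0 < n' := Nat.pos_of_mul_pos_left hn
    have hrel' : Z * ρ Z = (1 + μ ^ 2) ^ (2 * (p - 1)) * (ε ^ 2 * ((n' : AdjoinRoot (cyclotomic (4 * p) ℤ)) ^ 2 *
        (μ ^ (p * j) * U))) := by
      rw [hrel, Nat.cast_mul, hpε]; ring
    obtain ⟨Z', hZ'⟩ := peel_iter hp hp8 hs (p - 1) Z _ hrel'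
    have hev : Even (p - 1) := hp.even_sub_one hp2
    obtain ⟨h2, hh2⟩ := hev
    refine ih n' (by have := hp.two_le; nlinarith) hn' Z' ((-(-μ ^ 2)) ^ (p - 1) * ε ^ 2 * U)
      ((-1) ^ h2 * π ε * c) (mul_ne_zero (mul_ne_zero (pow_ne_zero _ (neg_ne_zero.2 one_ne_zero)) hπε) hc) ?_ ?_
    · rw [map_mul, map_mul, map_pow, map_pow, hπη, hU, hh2]; ring
    · rw [hZ']; ring
  · -- `p ∤ n`: reduce modulo `𝔓 = (p, μ - s)`
    have hnz : ((n : ℕ) : ZMod p) ≠ 0 := by rwa [Ne, ZMod.natCast_eq_zero_iff]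
    have h := congrArg π hrel
    rw [map_mul, hπρ, map_mul, map_mul, map_pow, map_natCast, hU] at h
    -- `x = π Z / (n c)` has `x² = π(μ^{pj})`, `x⁴ = -1`
    set x : ZMod p := π Z / ((n : ZMod p) * c) with hx_def
    have hx2 : x ^ 2 = π (μ ^ (p * j)) := by
      rw [hx_def, div_pow, div_eq_iff (pow_ne_zero 2 (mul_ne_zero hnz hc))]
      linear_combination h
    have hx4 : x ^ 4 = -1 := by rw [show (4 : ℕ) = 2 * 2 by norm_num, pow_mul, hx2, hω]
    have hx0 : x ≠ 0 := by
      intro h0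
      rw [h0] at hx4
      norm_num at hx4
    -- Fermat versus `x^{p-1} = (x⁴)^{(p-1)/4} = -1`
    have hF := ZMod.pow_card_sub_one_eq_one hx0
    obtain ⟨k, hk⟩ : ∃ k, p = 8 * k + 5 := ⟨p / 8, by omega⟩
    rw [show p - 1 = 4 * (2 * k + 1) by omega, pow_mul, hx4, (show Odd (2 * k + 1) from ⟨k, rfl⟩).neg_one_pow] at hF
    have h2 : (2 : ZMod p) = 0 := by linear_combination -hF
    rw [show (2 : ZMod p) = ((2 : ℕ) : ZMod p) by norm_num, ZMod.natCast_eq_zero_iff] at h2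
    exact hp2 ((Nat.prime_dvd_prime_iff_eq hp Nat.prime_two).1 h2)

end Summit.HodgeConjecture.CorCM.CyclotomicFourP

end
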